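import Mathlib

/-!
# Primality of `c·x^α·y² − x^β·z³` — stub `stub_psiPrime` of line `refutation-cuspidal-edge` (crux stmt-ResolutionOfSingularities-18182, route ShadowGame)

For a field `κ`, `c ≠ 0` and `α = 0 ∨ β = 0`, the polynomial
`ψ = C c * X 0 ^ α * X 1 ^ 2 - X 0 ^ β * X 2 ^ 3` is prime in `MvPolynomial (Fin 3) κ`.
The ring is a UFD, so it suffices to prove irreducibility. If `α = 0` we single out `X 1`
and `ψ` becomes the unit `C c` times the monic quadratic `Y ^ 2 - c⁻¹ x^β z³` over the domain
`κ[x, z]`; if `β = 0` we single out `X 2` and `-ψ` becomes the monic cubic `Z ^ 3 - c x^α y²`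
over `κ[x, y]`. A monic polynomial of degree `2` or `3` over a domain is irreducible iff it has
no root, and a root is excluded by comparing degrees in one variable (`3` is odd, `3 ∤ 2`).
-/

noncomputable section

set_option linter.dupNamespace false

namespace Summit.ResolutionOfSingularities.ResolutionOfSingularities.Theorems.ShadowGameWinR.Negative

/-- Over a domain, a binomial `X ^ n - C m` with `2 ≤ n ≤ 3` such that no `r ^ n` equals `m`
is irreducible. [folklore] -/
theorem irreducible_X_pow_sub_C_of_forall_pow_ne {R : Type*} [CommRing R] [IsDomain R] (m : R)
    {n : ℕ} (hn2 : 2 ≤ n) (hn3 : n ≤ 3) (h : ∀ r : R, r ^ n ≠ m) :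
    Irreducible (Polynomial.X ^ n - Polynomial.C m : Polynomial R) := by
  have hn : n ≠ 0 := by omega
  have hmon : (Polynomial.X ^ n - Polynomial.C m : Polynomial R).Monic :=
    Polynomial.monic_X_pow_sub_C m hn
  have hdeg : (Polynomial.X ^ n - Polynomial.C m : Polynomial R).natDegree = n :=
    Polynomial.natDegree_X_pow_sub_C
  rw [hmon.irreducible_iff_roots_eq_zero_of_degree_le_three (by rwa [hdeg]) (by rwa [hdeg])]
  refine Multiset.eq_zero_of_forall_notMem fun r hr => ?_
  rw [Polynomial.mem_roots hmon.ne_zero, Polynomial.IsRoot.def, Polynomial.eval_sub,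
    Polynomial.eval_pow, Polynomial.eval_X, Polynomial.eval_C, sub_eq_zero] at hr
  exact h r hr

/-- In `κ[X₀, X₁]` an `n`-th power `r ^ n` can equal `a · X_j ^ β · X_i ^ k` (`a ≠ 0`, `i ≠ j`)
only if `n ∣ k`: compare the degrees in `X_i`. [folklore] -/
theorem pow_ne_C_mul_X_pow_mul_X_pow {κ : Type*} [Field κ] {a : κ} (ha : a ≠ 0) {i j : Fin 2}
    (hij : i ≠ j) (β k n : ℕ) (hnk : ¬ n ∣ k) (r : MvPolynomial (Fin 2) κ) :
    r ^ n ≠ MvPolynomial.C a * MvPolynomial.X j ^ β * MvPolynomial.X i ^ k := by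
  intro hr
  have h1 : MvPolynomial.degreeOf i
      (MvPolynomial.C a * MvPolynomial.X j ^ β * MvPolynomial.X i ^ k :
        MvPolynomial (Fin 2) κ) = k := by
    have hne : (MvPolynomial.C a * MvPolynomial.X j ^ β : MvPolynomial (Fin 2) κ) ≠ 0 :=
      mul_ne_zero (by simpa using ha) (pow_ne_zero _ (MvPolynomial.X_ne_zero _))
    rw [MvPolynomial.degreeOf_mul_X_self_pow_eq_add_of_ne_zero _ _ hne,
      MvPolynomial.degreeOf_mul_X_pow_of_ne _ hij, MvPolynomial.degreeOf_C, zero_add]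
  have h2 := congrArg (MvPolynomial.degreeOf i) hr
  rw [h1] at h2
  apply hnk
  rcases eq_or_ne r 0 with rfl | hr0
  · rcases Nat.eq_zero_or_pos n with rfl | hn
    · rw [pow_zero, MvPolynomial.degreeOf_one] at h2
      exact h2 ▸ dvd_refl 0
    · rw [zero_pow hn.ne', MvPolynomial.degreeOf_zero] at h2
      exact h2 ▸ dvd_zero n
  · rw [MvPolynomial.degreeOf_pow_eq _ _ _ hr0] at h2
    exact Dvd.intro _ h2

/-- The algebra equivalence `κ[X₀,X₁,X₂] ≃ κ[X₀,X₁][Y]` singling out the variable `X 1`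
(so `X 0 ↦ C (X 0)`, `X 1 ↦ Y`, `X 2 ↦ C (X 1)`). [folklore] -/
theorem exists_algEquiv_single_out_one (κ : Type*) [Field κ] :
    ∃ e : MvPolynomial (Fin 3) κ ≃ₐ[κ] Polynomial (MvPolynomial (Fin 2) κ),
      e (MvPolynomial.X 0) = Polynomial.C (MvPolynomial.X 0) ∧
      e (MvPolynomial.X 1) = Polynomial.X ∧
      e (MvPolynomial.X 2) = Polynomial.C (MvPolynomial.X 1) ∧
      ∀ a : κ, e (MvPolynomial.C a) = Polynomial.C (MvPolynomial.C a) := by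
  refine ⟨(MvPolynomial.renameEquiv κ (Equiv.swap (0 : Fin 3) 1)).trans
    (MvPolynomial.finSuccEquiv κ 2), ?_, ?_, ?_, fun a => ?_⟩
  · rw [AlgEquiv.trans_apply, MvPolynomial.renameEquiv_apply, MvPolynomial.rename_X,
      Equiv.swap_apply_left]
    exact MvPolynomial.finSuccEquiv_X_succ (j := 0)
  · rw [AlgEquiv.trans_apply, MvPolynomial.renameEquiv_apply, MvPolynomial.rename_X,
      Equiv.swap_apply_right]
    exact MvPolynomial.finSuccEquiv_X_zero
  · rw [AlgEquiv.trans_apply, MvPolynomial.renameEquiv_apply, MvPolynomial.rename_X,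
      Equiv.swap_apply_of_ne_of_ne (by decide) (by decide)]
    exact MvPolynomial.finSuccEquiv_X_succ (j := 1)
  · rw [AlgEquiv.trans_apply, MvPolynomial.renameEquiv_apply, MvPolynomial.rename_C,
      MvPolynomial.finSuccEquiv_apply, MvPolynomial.eval₂Hom_C, RingHom.comp_apply]

/-- The algebra equivalence `κ[X₀,X₁,X₂] ≃ κ[X₀,X₁][Z]` singling out the variable `X 2`
(so `X 0 ↦ C (X 1)`, `X 1 ↦ C (X 0)`, `X 2 ↦ Z`). [folklore] -/
theorem exists_algEquiv_single_out_two (κ : Type*) [Field κ] :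
    ∃ e : MvPolynomial (Fin 3) κ ≃ₐ[κ] Polynomial (MvPolynomial (Fin 2) κ),
      e (MvPolynomial.X 0) = Polynomial.C (MvPolynomial.X 1) ∧
      e (MvPolynomial.X 1) = Polynomial.C (MvPolynomial.X 0) ∧
      e (MvPolynomial.X 2) = Polynomial.X ∧
      ∀ a : κ, e (MvPolynomial.C a) = Polynomial.C (MvPolynomial.C a) := by
  refine ⟨(MvPolynomial.renameEquiv κ (Equiv.swap (0 : Fin 3) 2)).trans
    (MvPolynomial.finSuccEquiv κ 2), ?_, ?_, ?_, fun a => ?_⟩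
  · rw [AlgEquiv.trans_apply, MvPolynomial.renameEquiv_apply, MvPolynomial.rename_X,
      Equiv.swap_apply_left]
    exact MvPolynomial.finSuccEquiv_X_succ (j := 1)
  · rw [AlgEquiv.trans_apply, MvPolynomial.renameEquiv_apply, MvPolynomial.rename_X,
      Equiv.swap_apply_of_ne_of_ne (by decide) (by decide)]
    exact MvPolynomial.finSuccEquiv_X_succ (j := 0)
  · rw [AlgEquiv.trans_apply, MvPolynomial.renameEquiv_apply, MvPolynomial.rename_X,
      Equiv.swap_apply_right]
    exact MvPolynomial.finSuccEquiv_X_zero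
  · rw [AlgEquiv.trans_apply, MvPolynomial.renameEquiv_apply, MvPolynomial.rename_C,
      MvPolynomial.finSuccEquiv_apply, MvPolynomial.eval₂Hom_C, RingHom.comp_apply]

/-- For a field `κ`, `c ≠ 0` and `min α β = 0`, the weighted initial form
`c·x^α·y² − x^β·z³` is prime in `κ[x, y, z]`. [folklore] -/
theorem stub_psiPrime (κ : Type) [Field κ] (c : κ) (hc : c ≠ 0) (α β : ℕ) (h : α = 0 ∨ β = 0) :
    Prime (MvPolynomial.C c * MvPolynomial.X 0 ^ α * MvPolynomial.X 1 ^ 2 -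
      MvPolynomial.X 0 ^ β * MvPolynomial.X 2 ^ 3 : MvPolynomial (Fin 3) κ) := by
  rw [← UniqueFactorizationMonoid.irreducible_iff_prime]
  rcases h with rfl | rfl
  · -- `α = 0`: single out `y = X 1`.
    obtain ⟨e, he0, he1, he2, heC⟩ := exists_algEquiv_single_out_one κ
    refine (MulEquiv.irreducible_iff e).mp ?_
    have hcc : Polynomial.C (MvPolynomial.C c) * Polynomial.C (MvPolynomial.C c⁻¹) =
        (1 : Polynomial (MvPolynomial (Fin 2) κ)) := by
      rw [← map_mul, ← map_mul, mul_inv_cancel₀ hc, map_one, map_one]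
    have key : e (MvPolynomial.C c * MvPolynomial.X 0 ^ 0 * MvPolynomial.X 1 ^ 2 -
          MvPolynomial.X 0 ^ β * MvPolynomial.X 2 ^ 3) =
        Polynomial.C (MvPolynomial.C c) * (Polynomial.X ^ 2 - Polynomial.C
          (MvPolynomial.C c⁻¹ * MvPolynomial.X 0 ^ β * MvPolynomial.X 1 ^ 3)) := by
      simp only [map_sub, map_mul, map_pow, he0, he1, he2, heC]
      linear_combination (Polynomial.C (MvPolynomial.X 0) ^ β *
        Polynomial.C (MvPolynomial.X 1) ^ 3 : Polynomial (MvPolynomial (Fin 2) κ)) * hcc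
    have hu : IsUnit (Polynomial.C (MvPolynomial.C c) : Polynomial (MvPolynomial (Fin 2) κ)) :=
      ((Ne.isUnit hc).map MvPolynomial.C).map Polynomial.C
    rw [key, irreducible_isUnit_mul hu]
    exact irreducible_X_pow_sub_C_of_forall_pow_ne _ le_rfl (by norm_num)
      (fun r => pow_ne_C_mul_X_pow_mul_X_pow (inv_ne_zero hc) (by decide) β 3 2 (by norm_num) r)
  · -- `β = 0`: single out `z = X 2`.
    obtain ⟨e, he0, he1, he2, heC⟩ := exists_algEquiv_single_out_two κ
    refine (MulEquiv.irreducible_iff e).mp ?_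
    have key : e (MvPolynomial.C c * MvPolynomial.X 0 ^ α * MvPolynomial.X 1 ^ 2 -
          MvPolynomial.X 0 ^ 0 * MvPolynomial.X 2 ^ 3) =
        (-1) * (Polynomial.X ^ 3 - Polynomial.C
          (MvPolynomial.C c * MvPolynomial.X 1 ^ α * MvPolynomial.X 0 ^ 2)) := by
      simp only [map_sub, map_mul, map_pow, he0, he1, he2, heC]
      ring
    have hu : IsUnit (-1 : Polynomial (MvPolynomial (Fin 2) κ)) :=
      isUnit_iff_exists_inv.mpr ⟨-1, by ring⟩
    rw [key, irreducible_isUnit_mul hu]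
    exact irreducible_X_pow_sub_C_of_forall_pow_ne _ (by norm_num) le_rfl
      (fun r => pow_ne_C_mul_X_pow_mul_X_pow hc (by decide) α 2 3 (by norm_num) r)

end Summit.ResolutionOfSingularities.ResolutionOfSingularities.Theorems.ShadowGameWinR.Negative

end
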